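import Summits.KontsevichZagierPeriods.KontsevichZagierPeriods.Theorems.SoloBlindSecondBeta
import Summits.KontsevichZagierPeriods.KontsevichZagierPeriods.Theorems.SoloBlindQuinticSector
import HarnessLib

/-!
# The linear quintic sector: every `ℚ̄`-linear relation among level-5 Beta words is in the rules

Let `V₅ ⊂ Q = FormalRep ⧸ ⟨rules⟩ ⊗ K₀` be the `K₀`-span of `x_π` and of the classes
`[β(k/5 + m, l/5 + n)]`, `1 ≤ k, l ≤ 4`, `m, n ∈ ℕ` (all convergent Beta words of level `5` and
their translates).

* `betaQ_fifth_mem_fifthSpan`, `betaQ_fifth_shift_mem_fifthSpan`: `V₅` is spanned by FIVE classes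
  `x_π, β(1/5,1/5), β(1/5,2/5), β(4/5,4/5), β(3/5,3/5)` — one per Deligne–Koblitz–Ogus class
  `Π, A, B, C, D`. Inside the rules this uses: reflection (`Π`), the first-kind Green relations
  `β(1/5,1/5) = φ β(1/5,3/5)`, `β(2/5,2/5) = φ⁻¹ β(1/5,2/5)` (`SoloBlindCauchyBeta`), the NEW
  second-kind relations `3β(4/5,4/5) = φ β(2/5,4/5)`, `φ β(3/5,3/5) = 2 β(3/5,4/5)`
  (`SoloBlindSecondBeta`), symmetry and translation.
* `kz_fifthLinear`: if the five periods `π, B(1/5,1/5), B(1/5,2/5), B(4/5,4/5), B(3/5,3/5)` are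
  LINEARLY independent over `ℚ̄ ∩ ℝ`, then the period map is injective on `V₅`:
  every `K₀`-linear relation among level-5 Beta words (and `π`) with vanishing period is a
  consequence of the three Kontsevich–Zagier rules; `kz_fifthLinear_equivalent` is the
  representation-level form.

The hypothesis is a THEOREM in print — J. Wolfart, G. Wüstholz, *Der Überlagerungsradius gewisser
algebraischer Kurven und die Werte der Betafunktion an rationalen Stellen*, Math. Ann. 273 (1985)
1–15: the only `ℚ̄`-linear relations among the values `B(a,b)`, `(a,b) ∈ ℚ²`, are the
Deligne–Koblitz–Ogus ones (via Wüstholz's analytic subgroup theorem), and at prime level the DKO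
classes are exactly the `S₃`-orbits of exponent triples — in contrast with the ALGEBRAIC quintic
sector `kz_fifthSector`, whose hypothesis (Rohrlich–Lang at level 5) is open. So this is an
unconditional instance-scheme of the conjecture modulo carrying one published linear-independence
theorem as a hypothesis.
-/

noncomputable section

open Set

namespace Summit.KontsevichZagierPeriods.KontsevichZagierPeriods.Theorems

namespace SoloBlind

open Literature.NumberTheory.Transcendental
open Literature.NumberTheory.Transcendental.KZ

/-! ## The two second-kind relations at level 5 -/

/-- **Level 5, second kind (i)**: `(3/5) sin(4π/5) β(4/5, 4/5) = (1/5) sin(2π/5) β(2/5, 4/5)`,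
i.e. `3 β(4/5,4/5) = 2cos(π/5) β(2/5,4/5)`. -/
theorem betaQ_quintic_second₁ :
    (3 / 5 : K₀) • sinQ (4 / 5) • betaQ (4 / 5) (4 / 5) =
      (1 / 5 : K₀) • sinQ (2 / 5) • betaQ (2 / 5) (4 / 5) := by
  have h := betaQ_second_rat (4 / 5) (2 / 5) (by norm_num) (by norm_num) (by norm_num)
  norm_num at h
  exact h

/-- **Level 5, second kind (ii)**: `(1/5) sin(3π/5) β(3/5, 3/5) = (2/5) sin(4π/5) β(4/5, 3/5)`,
i.e. `cos(π/5) β(3/5,3/5) = β(3/5,4/5)`. -/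
theorem betaQ_quintic_second₂ :
    (1 / 5 : K₀) • sinQ (3 / 5) • betaQ (3 / 5) (3 / 5) =
      (2 / 5 : K₀) • sinQ (4 / 5) • betaQ (4 / 5) (3 / 5) := by
  have h := betaQ_second_rat (3 / 5) (4 / 5) (by norm_num) (by norm_num) (by norm_num)
  norm_num at h
  exact h

/-! ## The five generators -/

/-- `x_π, β(1/5,1/5), β(1/5,2/5), β(4/5,4/5), β(3/5,3/5)`. -/
def fifthLin : Fin 5 → Q :=
  ![xPi, betaQ (1 / 5) (1 / 5), betaQ (1 / 5) (2 / 5), betaQ (4 / 5) (4 / 5), betaQ (3 / 5) (3 / 5)]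

/-- The linear quintic sector `V₅`. -/
def fifthSpan : Submodule K₀ Q := Submodule.span K₀ (range fifthLin)

/-- Each generator lies in `V₅`. -/
theorem fifthLin_mem (i : Fin 5) : fifthLin i ∈ fifthSpan := Submodule.subset_span ⟨i, rfl⟩

/-- `x_π ∈ V₅`. -/
theorem xPi_mem_fifthSpan : xPi ∈ fifthSpan := fifthLin_mem 0
/-- `β(1/5,1/5) ∈ V₅`. -/
theorem beta11_mem : betaQ (1 / 5) (1 / 5) ∈ fifthSpan := fifthLin_mem 1
/-- `β(1/5,2/5) ∈ V₅`. -/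
theorem beta12_mem : betaQ (1 / 5) (2 / 5) ∈ fifthSpan := fifthLin_mem 2
/-- `β(4/5,4/5) ∈ V₅`. -/
theorem beta44_mem : betaQ (4 / 5) (4 / 5) ∈ fifthSpan := fifthLin_mem 3
/-- `β(3/5,3/5) ∈ V₅`. -/
theorem beta33_mem : betaQ (3 / 5) (3 / 5) ∈ fifthSpan := fifthLin_mem 4

/-- Division by a nonzero scalar inside a subspace. -/
theorem mem_of_smul_eq {S : Submodule K₀ Q} {c : K₀} (hc : c ≠ 0) {x y : Q} (h : c • x = y)
    (hy : y ∈ S) : x ∈ S := by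
  have e : x = c⁻¹ • y := by rw [← h, inv_smul_smul₀ hc]
  rw [e]
  exact S.smul_mem _ hy

/-- `sin(πa) ≠ 0` in `K₀` for `0 < a < 1`. -/
theorem sinQ_ne_zero {a : ℚ} (h0 : 0 < a) (h1 : a < 1) : sinQ a ≠ 0 := fun h => by
  have h' : (sinQ a : ℝ) = 0 := by rw [h]; rfl
  rw [sinQ_val] at h'
  have ha : (0 : ℝ) < a := by exact_mod_cast h0
  have ha1 : (a : ℝ) < 1 := by exact_mod_cast h1
  exact (Real.sin_pos_of_pos_of_lt_pi (mul_pos Real.pi_pos ha)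
    (by nlinarith [Real.pi_pos])).ne' h'

/-! ## The sixteen level-5 words lie in `V₅` -/

/-- Class `A`: `β(1/5,3/5) = φ⁻¹ β(1/5,1/5) ∈ V₅`. -/
theorem beta13_mem : betaQ (1 / 5) (3 / 5) ∈ fifthSpan :=
  mem_of_smul_eq twoCosFifth_one_ne_zero betaQ_fifth_fifth.1.symm beta11_mem

/-- Class `B`: `β(2/5,2/5) ∈ V₅`. -/
theorem beta22_mem : betaQ (2 / 5) (2 / 5) ∈ fifthSpan := by
  rw [betaQ_two_two]; exact fifthSpan.smul_mem _ beta12_mem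

/-- Class `Π`: `β(1/5,4/5) ∈ V₅` (reflection). -/
theorem beta14_mem : betaQ (1 / 5) (4 / 5) ∈ fifthSpan := by
  rw [betaQ_one_four]; exact fifthSpan.smul_mem _ xPi_mem_fifthSpan

/-- Class `Π`: `β(2/5,3/5) ∈ V₅` (reflection). -/
theorem beta23_mem : betaQ (2 / 5) (3 / 5) ∈ fifthSpan := by
  rw [betaQ_two_three]; exact fifthSpan.smul_mem _ xPi_mem_fifthSpan

/-- Class `C` (second kind): `β(2/5,4/5) ∈ V₅`. -/
theorem beta24_mem : betaQ (2 / 5) (4 / 5) ∈ fifthSpan := by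
  have h := betaQ_quintic_second₁
  have hc : ((1 / 5 : K₀) * sinQ (2 / 5)) ≠ 0 :=
    mul_ne_zero (by norm_num) (sinQ_ne_zero (by norm_num) (by norm_num))
  refine mem_of_smul_eq hc ?_ (fifthSpan.smul_mem ((3 / 5 : K₀) * sinQ (4 / 5)) beta44_mem)
  rw [mul_smul, mul_smul, h]

/-- Class `D` (second kind): `β(4/5,3/5) ∈ V₅`. -/
theorem beta43_mem : betaQ (4 / 5) (3 / 5) ∈ fifthSpan := by
  have h := betaQ_quintic_second₂
  have hc : ((2 / 5 : K₀) * sinQ (4 / 5)) ≠ 0 :=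
    mul_ne_zero (by norm_num) (sinQ_ne_zero (by norm_num) (by norm_num))
  refine mem_of_smul_eq hc ?_ (fifthSpan.smul_mem ((1 / 5 : K₀) * sinQ (3 / 5)) beta33_mem)
  rw [mul_smul, mul_smul, ← h]

/-- **All sixteen convergent level-5 Beta words lie in `V₅`.** -/
theorem betaQ_fifth_mem_fifthSpan (k l : ℕ) (hk : 1 ≤ k) (hk4 : k ≤ 4) (hl : 1 ≤ l) (hl4 : l ≤ 4) :
    betaQ ((k : ℚ) / 5) ((l : ℚ) / 5) ∈ fifthSpan := by
  have s31 : betaQ (3 / 5) (1 / 5) ∈ fifthSpan := by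
    rw [betaQ_symm (by norm_num) (by norm_num)]; exact beta13_mem
  have s21 : betaQ (2 / 5) (1 / 5) ∈ fifthSpan := by
    rw [betaQ_symm (by norm_num) (by norm_num)]; exact beta12_mem
  have s41 : betaQ (4 / 5) (1 / 5) ∈ fifthSpan := by
    rw [betaQ_symm (by norm_num) (by norm_num)]; exact beta14_mem
  have s32 : betaQ (3 / 5) (2 / 5) ∈ fifthSpan := by
    rw [betaQ_symm (by norm_num) (by norm_num)]; exact beta23_mem
  have s42 : betaQ (4 / 5) (2 / 5) ∈ fifthSpan := by
    rw [betaQ_symm (by norm_num) (by norm_num)]; exact beta24_mem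
  have s34 : betaQ (3 / 5) (4 / 5) ∈ fifthSpan := by
    rw [betaQ_symm (by norm_num) (by norm_num)]; exact beta43_mem
  interval_cases k <;> interval_cases l <;> norm_num
  exacts [beta11_mem, beta12_mem, beta13_mem, beta14_mem, s21, beta22_mem, beta23_mem, beta24_mem,
    s31, s32, beta33_mem, s34, s41, s42, beta43_mem, beta44_mem]

/-! ## Translations -/

/-- Translation closure of a subspace: `β(a,b) ∈ S ⇒ β(a,b+1) ∈ S`. -/
theorem betaQ_transl_memSpan {S : Submodule K₀ Q} {a b : ℚ} (ha : 0 < a) (hb : 0 < b)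
    (h : betaQ a b ∈ S) : betaQ a (b + 1) ∈ S := by
  have hab : ((a + b : ℚ) : K₀) ≠ 0 := by exact_mod_cast (add_pos ha hb).ne'
  exact mem_of_smul_eq hab (betaQ_transl ha hb) (S.smul_mem _ h)

/-- `β(a,b) ∈ S ⇒ β(a+m,b+n) ∈ S` for all `m n : ℕ`. -/
theorem betaQ_shift_memSpan {S : Submodule K₀ Q} {a b : ℚ} (ha : 0 < a) (hb : 0 < b)
    (h : betaQ a b ∈ S) (m n : ℕ) : betaQ (a + m) (b + n) ∈ S := by
  have hm : betaQ (a + m) b ∈ S := by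
    induction m with
    | zero => simpa using h
    | succ k ih =>
      have hak : 0 < a + k := by positivity
      rw [betaQ_symm (by positivity) hb, Nat.cast_succ, ← add_assoc]
      rw [betaQ_symm hak hb] at ih
      exact betaQ_transl_memSpan hb hak ih
  induction n with
  | zero => simpa using hm
  | succ k ih =>
    rw [Nat.cast_succ, ← add_assoc]
    exact betaQ_transl_memSpan (by positivity) (by positivity) ih

/-- **Every translate `β(k/5 + m, l/5 + n)` lies in `V₅`.** -/
theorem betaQ_fifth_shift_mem_fifthSpan (k l : ℕ) (hk : 1 ≤ k) (hk4 : k ≤ 4) (hl : 1 ≤ l)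
    (hl4 : l ≤ 4) (m n : ℕ) : betaQ ((k : ℚ) / 5 + m) ((l : ℚ) / 5 + n) ∈ fifthSpan :=
  betaQ_shift_memSpan (by positivity) (by positivity) (betaQ_fifth_mem_fifthSpan k l hk hk4 hl hl4)
    m n

/-! ## The periods of the generators -/

/-- `evalQ ∘ fifthLin = (π, B(1/5,1/5), B(1/5,2/5), B(4/5,4/5), B(3/5,3/5))`. -/
theorem evalQ_fifthLin : (fun i => evalQ (fifthLin i)) =
    ![Real.pi, Real.Gamma (1 / 5) * Real.Gamma (1 / 5) / Real.Gamma (2 / 5),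
      Real.Gamma (1 / 5) * Real.Gamma (2 / 5) / Real.Gamma (3 / 5),
      Real.Gamma (4 / 5) * Real.Gamma (4 / 5) / Real.Gamma (8 / 5),
      Real.Gamma (3 / 5) * Real.Gamma (3 / 5) / Real.Gamma (6 / 5)] := by
  funext i
  fin_cases i
  · exact evalQ_xPi
  · show evalQ (betaQ (1 / 5) (1 / 5)) = _
    rw [evalQ_betaQ (by norm_num) (by norm_num)]; norm_num
  · show evalQ (betaQ (1 / 5) (2 / 5)) = _
    rw [evalQ_betaQ (by norm_num) (by norm_num)]; norm_num
  · show evalQ (betaQ (4 / 5) (4 / 5)) = _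
    rw [evalQ_betaQ (by norm_num) (by norm_num)]; norm_num
  · show evalQ (betaQ (3 / 5) (3 / 5)) = _
    rw [evalQ_betaQ (by norm_num) (by norm_num)]; norm_num

/-! ## The linear sector theorem -/

/-- **The Kontsevich–Zagier conjecture on the linear quintic sector.** If the five periods
`π, B(1/5,1/5), B(1/5,2/5), B(4/5,4/5), B(3/5,3/5)` are linearly independent over `K₀ = ℚ̄ ∩ ℝ`
(Wolfart–Wüstholz 1985), then every element of `V₅` with vanishing period is `0` in `Q`, i.e. every
`ℚ̄`-linear relation among level-5 Beta words and `π` is a consequence of the three rules. -/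
theorem kz_fifthLinear (h : LinearIndependent K₀ fun i => evalQ (fifthLin i)) {z : Q}
    (hz : z ∈ fifthSpan) (h0 : evalQ z = 0) : z = 0 := by
  obtain ⟨c, rfl⟩ := (Submodule.mem_span_range_iff_exists_fun K₀).mp hz
  have hsum : ∑ i, c i • evalQ (fifthLin i) = 0 := by
    rw [map_sum] at h0
    simpa only [evalQ_smul, IntermediateField.smul_def, smul_eq_mul] using h0
  have hc : ∀ i, c i = 0 := Fintype.linearIndependent_iff.mp h c hsum
  simp [hc]

/-- The period map is injective on `V₅` (same hypothesis). -/
theorem evalQ_injOn_fifthSpan (h : LinearIndependent K₀ fun i => evalQ (fifthLin i)) :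
    InjOn evalQ fifthSpan := fun x hx y hy hxy =>
  sub_eq_zero.mp (kz_fifthLinear h (fifthSpan.sub_mem hx hy) (by rw [map_sub, hxy, sub_self]))

/-- **Representation-level form.** Two integral representations whose classes are `K₀`-linear
combinations of level-5 Beta words and `π` and whose periods agree are equivalent under the
Kontsevich–Zagier rules (given Wolfart–Wüstholz linear independence). -/
theorem kz_fifthLinear_equivalent (h : LinearIndependent K₀ fun i => evalQ (fifthLin i))
    {n m : ℕ} (r : IntegralRep n) (r' : IntegralRep m) (hr : mkQ (of r) ∈ fifthSpan)
    (hr' : mkQ (of r') ∈ fifthSpan) (hv : r.value = r'.value) : Equivalent r r' := by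
  have hq : mkQ (of r) = mkQ (of r') :=
    evalQ_injOn_fifthSpan h hr hr' (by rw [evalQ_mkQ, evalQ_mkQ, eval_of, eval_of, hv])
  exact mkQ_eq_mkQ_iff.mp hq

/-- Example: `3·∫₀¹ (x(1-x))^{-1/5} dx` and `φ·∫₀¹ x^{-3/5}(1-x)^{-1/5} dx` — UNCONDITIONALLY
equivalent (the second-kind relation itself, no hypothesis). -/
theorem betaQ_four_four_prop :
    (3 : K₀) • betaQ (4 / 5) (4 / 5) = ((sinQ (4 / 5))⁻¹ * sinQ (2 / 5)) • betaQ (2 / 5) (4 / 5) := by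
  have h := betaQ_quintic_second₁
  have hs : sinQ (4 / 5) ≠ 0 := sinQ_ne_zero (by norm_num) (by norm_num)
  have h5 : (5 : K₀) ≠ 0 := by norm_num
  have e : (3 : K₀) • betaQ (4 / 5) (4 / 5) =
      ((sinQ (4 / 5))⁻¹ * 5) • ((3 / 5 : K₀) • sinQ (4 / 5) • betaQ (4 / 5) (4 / 5)) := by
    rw [smul_smul, smul_smul]
    congr 1
    field_simp
  rw [e, h, smul_smul, smul_smul]
  congr 1
  field_simp

end SoloBlind

end Summit.KontsevichZagierPeriods.KontsevichZagierPeriods.Theorems
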